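import Literature.AnabelianGeometry.SemiGraphs.TemperedVerticial
import Literature.AnabelianGeometry.SemiGraphs.TemperoidsResProofs
import HarnessLib

/-!
# Semi-graphs of anabelioids, §3, Proposition 3.6 (iv) — part 1: the pull-back functor
# `B^cov(G) ⥤ B^cov(G')` of a morphism `G' → G` of semi-graphs of anabelioids

Mochizuki, *Semi-graphs of anabelioids*, Publ. RIMS **42** (2006), §3, Proposition 3.6 (iv)
(manuscript p. 39) [cite: MochizukiSemiAnbd2006, Prop 3.6(iv) p.39]: "Any morphism of semi-graphs of
anabelioids `G' → G` induces a morphism of temperoids `B^temp(G') → B^temp(G)` [by pulling back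
tempered coverings of `G` to tempered coverings of `G'`]."  Towards the named fact
`InducedHomOfMorphism` of `TemperedVerticial.lean` (abc-iut-L3-t2), this file CONSTRUCTS the
pull-back functor on the categories `B^cov(−)` of the local presentation (`CovObj`,
`TemperedCoverings.lean`) for a morphism `F : Hom 𝒢' 𝒢` (Remark 2.4.2 p. 26: vertex and edge
homomorphisms compatible with the branch maps UP TO CONJUGATION): the vertex / edge objects of `F^* S`
are the restrictions of scalars `B^temp(F_v) S_{F v}`, `B^temp(F_e) S_{F e}`; the gluing along a
branch `b'` of `G'` is `B^temp(F_e)` of the gluing of `S` along `F b'`, re-indexed along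
`edgeOf (F b') = F (edgeOf b')`, followed by the natural isomorphism `B^temp(φ₁) ≅ B^temp(φ₂)` of
CONJUGATE homomorphisms (`BTemp.resIsoOfConj`, `TemperoidsResProofs.lean`) for a conjugating element
chosen once from the compatibility of `F` — the same pattern as abc-iut-L3-t7's `PullbackFunctor.lean`
for `B(−)`.  Definitional squares: `F^* ⋙ (S ↦ S_{v'}) = (S ↦ S_{F v'}) ⋙ B^temp(F_{v'})`.
Temperedness of `F^* S`, exactness, and the passage to `π₁^temp` (Prop. 3.2) are later parts.
Nothing here takes a side on [IUTchIII] Cor. 3.12.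
-/

noncomputable section

namespace Literature.AnabelianGeometry.SemiGraphs

namespace ProfiniteSemiGraph

open CategoryTheory

universe u

variable {𝒢' 𝒢 : ProfiniteSemiGraph.{u}}

/-! ### Bookkeeping: homomorphisms re-indexed along equalities of edges -/

variable (𝒢) in
/-- The branch homomorphism `b_* : Π_e → Π_v`, indexed by an edge `f` with a proof `edgeOf b = f`.
[cite: MochizukiSemiAnbd2006, Def 2.1 p.22] -/
def brHomAt (b : 𝒢.graph.Branch) (v : 𝒢.graph.Vertex) (h : 𝒢.graph.abuts b = some v)
    (f : 𝒢.graph.Edge) (q : 𝒢.graph.edgeOf b = f) : 𝒢.Ge f →ₜ* 𝒢.Gv v :=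
  q ▸ 𝒢.brHom b v h

/-- `brHomAt` at the tautological index is `b_*`. [cite: MochizukiSemiAnbd2006, Def 2.1 p.22] -/
@[simp] theorem brHomAt_rfl (b : 𝒢.graph.Branch) (v : 𝒢.graph.Vertex)
    (h : 𝒢.graph.abuts b = some v) : 𝒢.brHomAt b v h _ rfl = 𝒢.brHom b v h := rfl

/-- `brHomAt` evaluated: `b_*` of the transported element. [cite: MochizukiSemiAnbd2006, Def 2.1 p.22] -/
theorem brHomAt_apply (b : 𝒢.graph.Branch) (v : 𝒢.graph.Vertex) (h : 𝒢.graph.abuts b = some v)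
    {f : 𝒢.graph.Edge} (q : 𝒢.graph.edgeOf b = f) (y : 𝒢.Ge f) :
    𝒢.brHomAt b v h f q y = 𝒢.brHom b v h (q ▸ y) := by
  subst q
  rfl

namespace Hom

variable (F : Hom 𝒢' 𝒢)

/-- The edge homomorphism `F_{e'} : Π_{e'} → Π_{F e'}`, indexed by a target edge `f` with a proof
`F e' = f`. [cite: MochizukiSemiAnbd2006, Rmk 2.4.2 p.26] -/
def hEAt (e' : 𝒢'.graph.Edge) (f : 𝒢.graph.Edge) (p : F.base.edgeMap e' = f) :
    𝒢'.Ge e' →ₜ* 𝒢.Ge f :=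
  p ▸ F.hE e'

/-- `hEAt` at the tautological index is `F_{e'}`. [cite: MochizukiSemiAnbd2006, Rmk 2.4.2 p.26] -/
@[simp] theorem hEAt_rfl (e' : 𝒢'.graph.Edge) : F.hEAt e' _ rfl = F.hE e' := rfl

/-- The compatibility of `F` with the branch maps, at a re-indexed edge: for a branch `b'` of `G'`
abutting to `v'` and an edge `f` of `G` with `F (edgeOf b') = f = edgeOf (F b')`, the homomorphisms
`(F b')_* ∘ F_{e'}` and `F_{v'} ∘ b'_*` into `Π_{F v'}` are conjugate.
[cite: MochizukiSemiAnbd2006, Rmk 2.4.2 p.26] -/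
theorem exists_conj (b' : 𝒢'.graph.Branch) (v' : 𝒢'.graph.Vertex)
    (h' : 𝒢'.graph.abuts b' = some v') (f : 𝒢.graph.Edge)
    (p : F.base.edgeMap (𝒢'.graph.edgeOf b') = f)
    (q : 𝒢.graph.edgeOf (F.base.branchMap b') = f) :
    ∃ g : 𝒢.Gv (F.base.vertexMap v'), ∀ x : 𝒢'.Ge (𝒢'.graph.edgeOf b'),
      g * ((𝒢.brHomAt (F.base.branchMap b') (F.base.vertexMap v') (F.base.abuts_branchMap b' v' h')
        f q).comp (F.hEAt (𝒢'.graph.edgeOf b') f p)) x * g⁻¹ =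
        ((F.hV v').comp (𝒢'.brHom b' v' h')) x := by
  subst p
  obtain ⟨g, hg⟩ := F.comm b' v' h'
  refine ⟨g, fun x => ?_⟩
  change g * 𝒢.brHomAt _ _ _ _ q (F.hEAt _ _ rfl x) * g⁻¹ = F.hV v' (𝒢'.brHom b' v' h' x)
  rw [hg x, hEAt_rfl, brHomAt_apply]

end Hom


/-! ### Restriction of scalars: composition -/

/-- Restriction of scalars along a composite: `B^temp(φ) ∘ B^temp(ψ) = B^temp(ψ ∘ φ)` (definitional).
[cite: MochizukiSemiAnbd2006, Rmk 3.1.2 pp.33-34] -/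
def _root_.Literature.AnabelianGeometry.SemiGraphs.BTemp.resComp {G₁ G₂ G₃ : Type u} [Group G₁]
    [TopologicalSpace G₁] [Group G₂] [TopologicalSpace G₂] [Group G₃] [TopologicalSpace G₃]
    (ψ : G₂ →ₜ* G₃) (φ : G₁ →ₜ* G₂) : BTemp.res ψ ⋙ BTemp.res φ ≅ BTemp.res (ψ.comp φ) :=
  Iso.refl _

/-! ### The gluing of `B^cov(G)` along a branch, as a natural isomorphism -/

variable (𝒢) in
/-- The gluings `S_e ≅ b^* S_v` of the objects of `B^cov(G)` along a branch `b` of `e` abutting to `v`,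
as a natural isomorphism `(S ↦ S_f) ≅ (S ↦ S_v) ⋙ B^temp(b_*)` for any edge `f` with `edgeOf b = f`
(naturality = the compatibility `CovHom.comm`). [cite: MochizukiSemiAnbd2006, §3 p.36] -/
def glueNatIsoAt (b : 𝒢.graph.Branch) (v : 𝒢.graph.Vertex) (h : 𝒢.graph.abuts b = some v)
    (f : 𝒢.graph.Edge) (q : 𝒢.graph.edgeOf b = f) :
    restrictE 𝒢 f ≅ restrictV 𝒢 v ⋙ BTemp.res (𝒢.brHomAt b v h f q) := by
  subst q
  exact NatIso.ofComponents (fun S => S.glue b v h) (fun g => g.comm b v h)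

namespace Hom

variable (F : Hom 𝒢' 𝒢)

/-- `(F b')_* ∘ F_{e'} : Π_{e'} → Π_{F v'}` for a branch `b'` of `e'` abutting to `v'` (edge group of
`G` re-indexed along `edgeOf (F b') = F e'`). [cite: MochizukiSemiAnbd2006, Rmk 2.4.2 p.26] -/
def brComp (b' : 𝒢'.graph.Branch) (v' : 𝒢'.graph.Vertex) (h' : 𝒢'.graph.abuts b' = some v') :
    𝒢'.Ge (𝒢'.graph.edgeOf b') →ₜ* 𝒢.Gv (F.base.vertexMap v') :=
  (𝒢.brHomAt (F.base.branchMap b') (F.base.vertexMap v') (F.base.abuts_branchMap b' v' h')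
    (F.base.edgeMap (𝒢'.graph.edgeOf b')) (F.base.edgeOf_branchMap b')).comp
    (F.hE (𝒢'.graph.edgeOf b'))

/-- A conjugating element `g_{b'} ∈ Π_{F v'}` with `γ_g ∘ (F b')_* ∘ F_{e'} = F_{v'} ∘ b'_*`, CHOSEN
once from the compatibility of `F` (Remark 2.4.2: the compatibility holds only up to conjugation).
[cite: MochizukiSemiAnbd2006, Rmk 2.4.2 p.26] -/
def conjugator (b' : 𝒢'.graph.Branch) (v' : 𝒢'.graph.Vertex) (h' : 𝒢'.graph.abuts b' = some v') :
    𝒢.Gv (F.base.vertexMap v') :=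
  Classical.choose (F.exists_conj b' v' h' _ rfl (F.base.edgeOf_branchMap b'))

/-- The defining property of the chosen conjugating element. [cite: MochizukiSemiAnbd2006, Rmk 2.4.2 p.26] -/
theorem conjugator_spec (b' : 𝒢'.graph.Branch) (v' : 𝒢'.graph.Vertex)
    (h' : 𝒢'.graph.abuts b' = some v') (x : 𝒢'.Ge (𝒢'.graph.edgeOf b')) :
    F.conjugator b' v' h' * F.brComp b' v' h' x * (F.conjugator b' v' h')⁻¹ =
      ((F.hV v').comp (𝒢'.brHom b' v' h')) x :=
  Classical.choose_spec (F.exists_conj b' v' h' _ rfl (F.base.edgeOf_branchMap b')) x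

/-- The gluing of the pull-back along a branch `b'` of `e'` abutting to `v'`, as a natural isomorphism
of functors `B^cov(G) ⥤ B^temp(Π_{e'})`:
`(S ↦ S_{F e'}) ⋙ B^temp(F_{e'}) ≅ (S ↦ S_{F v'}) ⋙ B^temp((F b')_*) ⋙ B^temp(F_{e'})`
`= (S ↦ S_{F v'}) ⋙ B^temp((F b')_* ∘ F_{e'}) ≅ (S ↦ S_{F v'}) ⋙ B^temp(F_{v'} ∘ b'_*)` — the gluing
of `S` along `F b'`, then the isomorphism of pull-backs along conjugate homomorphisms.
[cite: MochizukiSemiAnbd2006, Prop 3.6(iv) p.39] -/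
def gluingIso (b' : 𝒢'.graph.Branch) (v' : 𝒢'.graph.Vertex)
    (h' : 𝒢'.graph.abuts b' = some v') :
    restrictE 𝒢 (F.base.edgeMap (𝒢'.graph.edgeOf b')) ⋙ BTemp.res (F.hE (𝒢'.graph.edgeOf b')) ≅
      restrictV 𝒢 (F.base.vertexMap v') ⋙
        (BTemp.res (F.hV v') ⋙ BTemp.res (𝒢'.brHom b' v' h')) :=
  Functor.isoWhiskerRight
      (𝒢.glueNatIsoAt (F.base.branchMap b') (F.base.vertexMap v') (F.base.abuts_branchMap b' v' h')
        (F.base.edgeMap (𝒢'.graph.edgeOf b')) (F.base.edgeOf_branchMap b'))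
      (BTemp.res (F.hE (𝒢'.graph.edgeOf b'))) ≪≫
    Functor.associator _ _ _ ≪≫
    Functor.isoWhiskerLeft (restrictV 𝒢 (F.base.vertexMap v'))
      (BTemp.resComp _ _ ≪≫
        BTemp.resIsoOfConj (F.brComp b' v' h') ((F.hV v').comp (𝒢'.brHom b' v' h'))
          (F.conjugator b' v' h') (F.conjugator_spec b' v' h') ≪≫
        (BTemp.resComp (F.hV v') (𝒢'.brHom b' v' h')).symm)

/-! ### The pull-back functor `F^* : B^cov(G) ⥤ B^cov(G')` -/

/-- The pull-back `F^* S ∈ B^cov(G')` of `S ∈ B^cov(G)`: vertex objects `B^temp(F_{v'}) S_{F v'}`, edge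
objects `B^temp(F_{e'}) S_{F e'}`, glued along `b'` by `gluingIso`.
[cite: MochizukiSemiAnbd2006, Prop 3.6(iv) p.39] -/
def covPullbackObj (S : CovObj 𝒢) : CovObj 𝒢' where
  SV v' := (BTemp.res (F.hV v')).obj (S.SV (F.base.vertexMap v'))
  SE e' := (BTemp.res (F.hE e')).obj (S.SE (F.base.edgeMap e'))
  glue b' v' h' := (F.gluingIso b' v' h').app S

/-- The pull-back of a morphism of `B^cov(G)` (componentwise restriction of scalars); compatibility
with the gluings is the naturality of `gluingIso`. [cite: MochizukiSemiAnbd2006, Prop 3.6(iv) p.39] -/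
def covPullbackMap {S T : CovObj 𝒢} (f : S ⟶ T) : F.covPullbackObj S ⟶ F.covPullbackObj T where
  fV v' := (BTemp.res (F.hV v')).map (f.fV (F.base.vertexMap v'))
  fE e' := (BTemp.res (F.hE e')).map (f.fE (F.base.edgeMap e'))
  comm b' v' h' := (F.gluingIso b' v' h').hom.naturality f

/-- **[SemiAnbd] Proposition 3.6 (iv), the construction**: the pull-back functor
`F^* : B^cov(G) ⥤ B^cov(G')` of a morphism `F : G' → G` of semi-graphs of anabelioids ("pulling back
… coverings of `G` to … coverings of `G'`"). [cite: MochizukiSemiAnbd2006, Prop 3.6(iv) p.39] -/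
def covPullback : CovObj 𝒢 ⥤ CovObj 𝒢' where
  obj S := F.covPullbackObj S
  map f := F.covPullbackMap f
  map_id S := by
    refine CovHom.ext ?_ ?_ <;> funext _ <;> simp [covPullbackMap, covPullbackObj]
  map_comp f g := by
    refine CovHom.ext ?_ ?_ <;> funext _
    · exact (BTemp.res _).map_comp _ _
    · exact (BTemp.res _).map_comp _ _

/-- Vertex objects of the pull-back: `(F^* S)_{v'} = B^temp(F_{v'}) S_{F v'}`.
[cite: MochizukiSemiAnbd2006, Prop 3.6(iv) p.39] -/
@[simp] theorem covPullback_obj_SV (S : CovObj 𝒢) (v' : 𝒢'.graph.Vertex) :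
    (F.covPullback.obj S).SV v' = (BTemp.res (F.hV v')).obj (S.SV (F.base.vertexMap v')) := rfl

/-- Edge objects of the pull-back: `(F^* S)_{e'} = B^temp(F_{e'}) S_{F e'}`.
[cite: MochizukiSemiAnbd2006, Prop 3.6(iv) p.39] -/
@[simp] theorem covPullback_obj_SE (S : CovObj 𝒢) (e' : 𝒢'.graph.Edge) :
    (F.covPullback.obj S).SE e' = (BTemp.res (F.hE e')).obj (S.SE (F.base.edgeMap e')) := rfl

/-- Vertex components of pulled-back morphisms. [cite: MochizukiSemiAnbd2006, Prop 3.6(iv) p.39] -/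
@[simp] theorem covPullback_map_fV {S T : CovObj 𝒢} (f : S ⟶ T) (v' : 𝒢'.graph.Vertex) :
    (F.covPullback.map f).fV v' = (BTemp.res (F.hV v')).map (f.fV (F.base.vertexMap v')) := rfl

/-- Edge components of pulled-back morphisms. [cite: MochizukiSemiAnbd2006, Prop 3.6(iv) p.39] -/
@[simp] theorem covPullback_map_fE {S T : CovObj 𝒢} (f : S ⟶ T) (e' : 𝒢'.graph.Edge) :
    (F.covPullback.map f).fE e' = (BTemp.res (F.hE e')).map (f.fE (F.base.edgeMap e')) := rfl

/-- **Compatibility with restriction to a vertex**: `F^* ⋙ (S ↦ S_{v'}) = (S ↦ S_{F v'}) ⋙ B^temp(F_{v'})`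
— the square behind the compatibility of the induced `π₁^temp(G') → π₁^temp(G)` with the verticial
homomorphisms (Prop. 3.6 (iv) / Thm. 3.7 (i)). [cite: MochizukiSemiAnbd2006, Prop 3.6(iv) p.39] -/
theorem covPullback_comp_restrictV (v' : 𝒢'.graph.Vertex) :
    F.covPullback ⋙ restrictV 𝒢' v' = restrictV 𝒢 (F.base.vertexMap v') ⋙ BTemp.res (F.hV v') :=
  rfl

/-- Compatibility with restriction to an edge: `F^* ⋙ (S ↦ S_{e'}) = (S ↦ S_{F e'}) ⋙ B^temp(F_{e'})`.
[cite: MochizukiSemiAnbd2006, Prop 3.6(iv) p.39] -/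
theorem covPullback_comp_restrictE (e' : 𝒢'.graph.Edge) :
    F.covPullback ⋙ restrictE 𝒢' e' = restrictE 𝒢 (F.base.edgeMap e') ⋙ BTemp.res (F.hE e') :=
  rfl

end Hom


/-! ### `F^*` preserves tempered objects: `F^* : B^temp(G) ⥤ B^temp(G')` -/

/-- Underlying function of the gluing natural isomorphism `glueNatIsoAt` (re-indexed gluing of `S`).
[cite: MochizukiSemiAnbd2006, §3 p.36] -/
theorem glueNatIsoAt_hom_app_apply (b : 𝒢.graph.Branch) (v : 𝒢.graph.Vertex)
    (h : 𝒢.graph.abuts b = some v) {f : 𝒢.graph.Edge} (q : 𝒢.graph.edgeOf b = f) (S : CovObj 𝒢)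
    (x : (S.SE f).obj.V) :
    ((𝒢.glueNatIsoAt b v h f q).hom.app S).hom.hom x = (S.glue b v h).hom.hom.hom (q ▸ x) := by
  subst q
  rfl

/-- Re-indexing a point of an edge fibre along an equality of edges does not change the point.
[cite: MochizukiSemiAnbd2006, Def 3.5(ii) p.37] -/
theorem CovObj.point_inr_cast (S : CovObj 𝒢) {f f' : 𝒢.graph.Edge} (q : f = f')
    (x : (S.SE f').obj.V) : (Sum.inr ⟨f', x⟩ : S.Point) = Sum.inr ⟨f, q ▸ x⟩ := by
  subst q
  rfl

namespace Hom

variable (F : Hom 𝒢' 𝒢)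

/-- The map on points `F^* S → S` over `F`: a point of the fibre of `F^* S` over `v'` (resp. `e'`) IS a
point of the fibre of `S` over `F v'` (resp. `F e'`). [cite: MochizukiSemiAnbd2006, Prop 3.6(iv) p.39] -/
def pointMap (S : CovObj 𝒢) : (F.covPullback.obj S).Point → S.Point
  | Sum.inl ⟨v', x⟩ => Sum.inl ⟨F.base.vertexMap v', x⟩
  | Sum.inr ⟨e', x⟩ => Sum.inr ⟨F.base.edgeMap e', x⟩

/-- Underlying function of the gluing of `F^* S` along `b'`: the re-indexed gluing of `S` along `F b'`
followed by the action of the chosen conjugating element. [cite: MochizukiSemiAnbd2006, Prop 3.6(iv) p.39] -/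
theorem covPullback_glue_apply (S : CovObj 𝒢) (b' : 𝒢'.graph.Branch) (v' : 𝒢'.graph.Vertex)
    (h' : 𝒢'.graph.abuts b' = some v')
    (x : ((F.covPullback.obj S).SE (𝒢'.graph.edgeOf b')).obj.V) :
    ((F.covPullback.obj S).glue b' v' h').hom.hom.hom x =
      (S.SV (F.base.vertexMap v')).obj.ρ (F.conjugator b' v' h')
        ((S.glue (F.base.branchMap b') (F.base.vertexMap v') (F.base.abuts_branchMap b' v' h')).hom.hom.hom
          (F.base.edgeOf_branchMap b' ▸ x)) := by
  change (S.SV (F.base.vertexMap v')).obj.ρ (F.conjugator b' v' h')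
      (((𝒢.glueNatIsoAt (F.base.branchMap b') (F.base.vertexMap v') (F.base.abuts_branchMap b' v' h')
        _ (F.base.edgeOf_branchMap b')).hom.app S).hom.hom x) = _
  rw [glueNatIsoAt_hom_app_apply]

/-- Points of `F^* S` in one connected component map to points of `S` in one connected component.
[cite: MochizukiSemiAnbd2006, Prop 3.6(iv) p.39] -/
theorem sameComponent_pointMap (S : CovObj 𝒢) {p q : (F.covPullback.obj S).Point}
    (hpq : (F.covPullback.obj S).SameComponent p q) :
    S.SameComponent (F.pointMap S p) (F.pointMap S q) := by
  induction hpq with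
  | rel a b hab =>
    cases hab with
    | vertex v' g x =>
      exact Relation.EqvGen.rel _ _ (CovObj.Adj.vertex (F.base.vertexMap v') (F.hV v' g) x)
    | edge e' g x =>
      exact Relation.EqvGen.rel _ _ (CovObj.Adj.edge (F.base.edgeMap e') (F.hE e' g) x)
    | glue b' v' h' x =>
      change S.SameComponent (Sum.inr ⟨F.base.edgeMap (𝒢'.graph.edgeOf b'), x⟩)
        (Sum.inl ⟨F.base.vertexMap v', ((F.covPullback.obj S).glue b' v' h').hom.hom.hom x⟩)
      rw [covPullback_glue_apply, S.point_inr_cast (F.base.edgeOf_branchMap b') x]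
      exact Relation.EqvGen.trans _ _ _
        (Relation.EqvGen.rel _ _ (CovObj.Adj.glue (F.base.branchMap b') (F.base.vertexMap v')
          (F.base.abuts_branchMap b' v' h') _))
        (Relation.EqvGen.rel _ _ (CovObj.Adj.vertex _ (F.conjugator b' v' h') _))
  | refl a => exact Relation.EqvGen.refl _
  | symm a b _ ih => exact Relation.EqvGen.symm _ _ ih
  | trans a b c _ _ ih₁ ih₂ => exact Relation.EqvGen.trans _ _ _ ih₁ ih₂

/-- `F^*` of a finite object is finite. [cite: MochizukiSemiAnbd2006, Prop 3.6(iv) p.39] -/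
theorem isFinite_covPullback {T : CovObj 𝒢} (hT : T.IsFinite) : (F.covPullback.obj T).IsFinite :=
  ⟨fun v' => hT.finite_V (F.base.vertexMap v'), fun e' => hT.finite_E (F.base.edgeMap e')⟩

/-- `F^*` of an object with nonempty fibres has nonempty fibres. [cite: MochizukiSemiAnbd2006, Prop 3.6(iv) p.39] -/
theorem hasNonemptyFibres_covPullback {T : CovObj 𝒢} (hT : T.HasNonemptyFibres) :
    (F.covPullback.obj T).HasNonemptyFibres :=
  ⟨fun v' => hT.nonempty_V (F.base.vertexMap v'), fun e' => hT.nonempty_E (F.base.edgeMap e')⟩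

/-- Splitting is preserved by `F^*`: if `T` splits `S` at the image point, `F^* T` splits `F^* S`.
[cite: MochizukiSemiAnbd2006, Prop 3.6(iv) p.39] -/
theorem splitsAt_covPullback {T S : CovObj 𝒢} {q : (F.covPullback.obj S).Point}
    (h : T.SplitsAt S (F.pointMap S q)) : (F.covPullback.obj T).SplitsAt (F.covPullback.obj S) q := by
  rcases q with ⟨v', s⟩ | ⟨e', s⟩
  · exact fun x g' hx => h x (F.hV v' g') hx
  · exact fun x g' hx => h x (F.hE e' g') hx

/-- **`F^*` preserves tempered coverings** (Def. 3.5 (ii)): the finite étale covering splitting a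
component of `S` pulls back to one splitting the corresponding component of `F^* S`.
[cite: MochizukiSemiAnbd2006, Prop 3.6(iv) p.39] -/
theorem isTempered_covPullback {S : CovObj 𝒢} (hS : S.IsTempered) : (F.covPullback.obj S).IsTempered := by
  intro p
  obtain ⟨T, hTfin, hTne, hsplit⟩ := hS (F.pointMap S p)
  exact ⟨F.covPullback.obj T, F.isFinite_covPullback hTfin, F.hasNonemptyFibres_covPullback hTne,
    fun q hpq => F.splitsAt_covPullback (hsplit _ (F.sameComponent_pointMap S hpq))⟩

/-- **[SemiAnbd] Proposition 3.6 (iv), the functor `B^temp(G) → B^temp(G')`** ("by pulling back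
tempered coverings of `G` to tempered coverings of `G'`"): `F^*` restricted to the tempered objects.
[cite: MochizukiSemiAnbd2006, Prop 3.6(iv) p.39] -/
def btempPullback : BTempCat 𝒢 ⥤ BTempCat 𝒢' :=
  ObjectProperty.lift _ (ObjectProperty.ι _ ⋙ F.covPullback) fun S => F.isTempered_covPullback S.property

/-- `F^*` on `B^temp` lies over `F^*` on `B^cov` (definitional). [cite: MochizukiSemiAnbd2006, Prop 3.6(iv) p.39] -/
theorem btempPullback_comp_ι :
    F.btempPullback ⋙ ObjectProperty.ι _ = ObjectProperty.ι _ ⋙ F.covPullback := rfl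

end Hom

end ProfiniteSemiGraph

end Literature.AnabelianGeometry.SemiGraphs

end
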